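import Literature.AlgebraicGeometry.Resolution.AlterationsSemiStableThickness
import Literature.AlgebraicGeometry.Resolution.StalkSpecializesLocalization
import Literature.AlgebraicGeometry.Resolution.StrictNormalCrossingsFlatDescent
import Literature.RingTheory.FittingIdeal.Etale
import Literature.RingTheory.FittingIdeal.FreeModule
import Mathlib.AlgebraicGeometry.Morphisms.Smooth
import HarnessLib

/-!
# De Jong's alteration theorem, 3.3: "By assumption we have `V(h) ⊂ V(t₁ ⋯ t_r)`" — the singular
# scheme `Sing(f)` at the generizations of a point, from smoothness over `Y ∖ D`

Topic: `Literature/AlgebraicGeometry/Resolution`. In de Jong 1996, 3.3 the exponents of the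
local form `B ≅ A⟦u, v⟧/(uv - h)` of a semi-stable curve `f : X → S` smooth over `S ∖ D` are
read off from ONE geometric input:

> "The singular locus of `f` traced on `Spec B` maps isomorphically to the closed subscheme
> `V(h) ⊂ Spec A'`. By assumption we have `V(h) ⊂ V(t₁ ⋯ t_r)`." (p. 63)

i.e. `Sing(f) ⊆ f⁻¹(D)` near `x`, with `Sing(f)` the closed subscheme of 2.21 ("defined by the
first Fitting ideal of the sheaf `Ω_{X/S}`"; stalk `Fitt₁(Ω_{X/S})_x = Scheme.Hom.singFittingIdeal f x`,
`AlterationsSemiStableThickness.lean`) and "by assumption" = 3.1 "`f : X → S` smooth over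
`S ∖ D`". This file PROVES that input in the form the formal analysis consumes — at the level of
the local ring `𝒪_{X,x}` and its primes (= the generizations `x' ⤳ x`, Stacks 01J7):

* `Module.fittingIdeal_eq_bot_or_eq_top_of_free` — the Fitting ideals of a finite free module
  are `0` or `R` (`Module.fittingIdeal_of_basis`, `FreeModule.lean`: Stacks 07Z7);
* `fittingIdeal_kaehlerDifferential_eq_bot_or_eq_top` — for a LOCAL algebra `S'` formally smooth
  and essentially of finite type over `R`, `Ω_{S'/R}` is finite projective, hence free, so each
  `Fitt_k(Ω_{S'/R})` is `0` or `S'`;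
* `formallySmooth_stalk_of_specializes_of_mem_smoothLocus` — if a generization `x' ⤳ x` lies in
  the smooth locus of `f : X → Y` (locally of finite presentation), then `𝒪_{X,x'}` is formally
  smooth over `𝒪_{Y,f x}` (smooth over `𝒪_{Y,f x'}`, itself a localization of `𝒪_{Y,f x}`);
* `DeJong1996.SemiStablePair.exists_notMem_forall_mul_singFittingIdeal_eq_zero` — **3.3 for
  the curve of Situation 4.23**: for a prime `𝔭 ⊇ Fitt₁(Ω)_x` of `𝒪_{X,x}` NOT containing the
  image of the stalk `I(D)_{f x}` of the ideal of `D`, some `s ∉ 𝔭` kills `Fitt₁(Ω)_x`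
  (`Fitt₁(Ω)_x · 𝒪_{X,x'} = 0` at the corresponding generization `x'`, which lies over `Y ∖ D`,
  hence in the smooth locus, where `Fitt₁` of the free `Ω` is `0` or everything, and it is not
  everything inside `𝔭`). Combined with the formal structure 2.23 (`Fitt₁ · 𝒪̂ = (u, v)`, no
  non-zero `s` kills both `u` and `v`) this yields `I(D)_{f x} 𝒪_{X,x} ⊆ √Fitt₁(Ω)_x`, i.e.
  `V(h) ⊆ V(t₁ ⋯ t_r)`.

## Sources

* A. J. de Jong, *Smoothness, semi-stability and alterations*, Publ. Math. IHÉS 83 (1996), 2.21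
  (p. 61), 3.1, 3.3 (pp. 62–63).
* The Stacks Project, Tags 01J7 (points of `Spec 𝒪_{X,x}`), 07ZA–07ZC (Fitting ideals), 00TH
  (smooth ⇒ `Ω` projective).
* D. Eisenbud, *Commutative Algebra*, GTM 150 (1995), §20.2, Cor. 20.5.
-/

noncomputable section

open CategoryTheory CategoryTheory.Limits AlgebraicGeometry TopologicalSpace IsLocalRing
  TensorProduct

namespace Literature.AlgebraicGeometry.Resolution

universe u v

open Literature.RingTheory.FittingIdeal

/-! ## Fitting ideals of free modules -/

section Free

variable {R : Type u} [CommRing R] {M : Type v} [AddCommGroup M] [Module R M]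

/-- **The Fitting ideals of a finite free module are `0` or `R`** (`0` below the rank, `R` from
the rank on). [cite: StacksProject, Tag 07ZB] -/
theorem Module.fittingIdeal_eq_bot_or_eq_top_of_free [Module.Free R M] [Module.Finite R M]
    (k : ℕ) : Module.fittingIdeal R M k = ⊥ ∨ Module.fittingIdeal R M k = ⊤ := by
  classical
  let ι := Module.Free.ChooseBasisIndex R M
  haveI : Fintype ι := Module.Free.ChooseBasisIndex.fintype R M
  let b : Module.Basis (Fin (Fintype.card ι)) R M :=
    (Module.Free.chooseBasis R M).reindex (Fintype.equivFin ι)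
  rw [Module.fittingIdeal_of_basis b k]
  split_ifs
  · exact Or.inr rfl
  · exact Or.inl rfl

end Free

/-! ## Fitting ideals of differentials: localization, and the formally smooth local case -/

section Kaehler

/-- **For a formally smooth local algebra the Fitting ideals of `Ω` are `0` or everything**: if
`S'` is local, formally smooth and essentially of finite type over `R`, then `Ω_{S'/R}` is a
finite projective (Stacks 00TH), hence free, `S'`-module, so `Fitt_k(Ω_{S'/R}) ∈ {0, S'}`.
[cite: StacksProject, Tag 07ZB] -/
theorem fittingIdeal_kaehlerDifferential_eq_bot_or_eq_top (R S' : Type u) [CommRing R]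
    [CommRing S'] [Algebra R S'] [IsLocalRing S'] [Algebra.FormallySmooth R S']
    [Algebra.EssFiniteType R S'] (k : ℕ) :
    Module.fittingIdeal S' Ω[S'⁄R] k = ⊥ ∨ Module.fittingIdeal S' Ω[S'⁄R] k = ⊤ := by
  haveI : Module.Projective S' Ω[S'⁄R] := inferInstance
  haveI : Module.Flat S' Ω[S'⁄R] := inferInstance
  haveI : Module.Free S' Ω[S'⁄R] := Module.free_of_flat_of_isLocalRing
  exact Module.fittingIdeal_eq_bot_or_eq_top_of_free k

/-- If a finitely generated ideal dies in the localization at a prime `𝔭`, one element outside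
`𝔭` kills it. [folklore] -/
theorem Ideal.exists_notMem_forall_mul_eq_zero_of_map_eq_bot {S S' : Type*} [CommRing S]
    [CommRing S'] [Algebra S S'] (P : Ideal S) [P.IsPrime] [IsLocalization.AtPrime S' P]
    {I : Ideal S} (hI : I.FG) (h : I.map (algebraMap S S') = ⊥) :
    ∃ s ∉ P, ∀ a ∈ I, s * a = 0 := by
  classical
  obtain ⟨T, rfl⟩ := hI
  have hgen : ∀ a ∈ (T : Set S), ∃ m : P.primeCompl, (m : S) * a = 0 := fun a ha => by
    have h0 : algebraMap S S' a = 0 := by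
      have : algebraMap S S' a ∈ (Ideal.span (T : Set S)).map (algebraMap S S') :=
        Ideal.mem_map_of_mem _ (Ideal.subset_span ha)
      rwa [h, Ideal.mem_bot] at this
    exact (IsLocalization.map_eq_zero_iff P.primeCompl S' a).mp h0
  choose m hm using hgen
  refine ⟨∏ a ∈ T.attach, (m a.1 a.2 : S), ?_, fun a ha => ?_⟩
  · intro hmem
    obtain ⟨a, -, ha⟩ := Ideal.IsPrime.prod_mem_iff.mp hmem
    exact (m a.1 a.2).2 ha
  · refine Submodule.span_induction (p := fun a _ => (∏ a ∈ T.attach, (m a.1 a.2 : S)) * a = 0)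
      ?_ ?_ ?_ ?_ ha
    · intro a haT
      obtain ⟨c, hc⟩ : (m a haT : S) ∣ ∏ a ∈ T.attach, (m a.1 a.2 : S) :=
        Finset.dvd_prod_of_mem (fun a : {a // a ∈ T} => (m a.1 a.2 : S)) (Finset.mem_attach T ⟨a, haT⟩)
      rw [hc, mul_comm _ c, mul_assoc, hm a haT, mul_zero]
    · exact mul_zero _
    · intro a b _ _ ha hb
      rw [mul_add, ha, hb, add_zero]
    · intro r a _ ha
      rw [smul_eq_mul, mul_left_comm, ha, mul_zero]

end Kaehler

/-! ## Smoothness at a generization, seen from the stalk at the point -/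

section Geometry

variable {X Y : Scheme.{u}} (f : X ⟶ Y)

/-- **A generization in the smooth locus gives a formally smooth localization of the stalk.**
For `f : X → Y` locally of finite presentation and `x' ⤳ x` with `x' ∈ sm(X/Y)`, the local ring
`𝒪_{X,x'}` — an algebra over `𝒪_{Y,f x}` through `𝒪_{Y,f x} → 𝒪_{X,x} → 𝒪_{X,x'}` — is formally
smooth over `𝒪_{Y,f x}`: it is formally smooth over `𝒪_{Y,f x'}`, which is a localization of
`𝒪_{Y,f x}` (Stacks 01J7), and the two structures agree by naturality of specialization maps.
[cite: StacksProject, Tag 01V9] -/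
theorem formallySmooth_stalk_of_specializes_of_mem_smoothLocus [LocallyOfFinitePresentation f]
    {x x' : X} (h : x' ⤳ x) (hx' : x' ∈ f.smoothLocus) :
    letI := ((X.presheaf.stalkSpecializes h).hom.comp (f.stalkMap x).hom).toAlgebra
    Algebra.FormallySmooth (Y.presheaf.stalk (f x)) (X.presheaf.stalk x') ∧
      Algebra.EssFiniteType (Y.presheaf.stalk (f x)) (X.presheaf.stalk x') := by
  have h' : f x' ⤳ f x := f.base.hom.map_specializes h
  set R := Y.presheaf.stalk (f x)
  set R' := Y.presheaf.stalk (f x')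
  set S' := X.presheaf.stalk x'
  letI algRS' : Algebra R S' := ((X.presheaf.stalkSpecializes h).hom.comp (f.stalkMap x).hom).toAlgebra
  letI algRR' : Algebra R R' := (Y.presheaf.stalkSpecializes h').hom.toAlgebra
  letI algR'S' : Algebra R' S' := (f.stalkMap x').hom.toAlgebra
  haveI : IsScalarTower R R' S' := IsScalarTower.of_algebraMap_eq' (by
    show (X.presheaf.stalkSpecializes h).hom.comp (f.stalkMap x).hom =
      (f.stalkMap x').hom.comp (Y.presheaf.stalkSpecializes h').hom
    rw [← CommRingCat.hom_comp, ← CommRingCat.hom_comp]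
    exact congrArg CommRingCat.Hom.hom (Scheme.Hom.stalkSpecializes_stalkMap f x' x h).symm)
  haveI : Algebra.FormallySmooth R' S' := Scheme.Hom.mem_smoothLocus.mp hx'
  haveI : IsLocalization.AtPrime R' (primeOfSpecializes h') :=
    isLocalizationAtPrime_stalkSpecializes h'
  haveI : Algebra.FormallySmooth R R' :=
    Algebra.FormallySmooth.of_isLocalization (Rₘ := R') (primeOfSpecializes h').primeCompl
  haveI : Algebra.EssFiniteType R' S' := LocallyOfFiniteType.stalkMap f x'
  haveI : Algebra.EssFiniteType R R' :=
    Algebra.EssFiniteType.of_isLocalization R' (primeOfSpecializes h').primeCompl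
  exact ⟨Algebra.FormallySmooth.comp R R' S', Algebra.EssFiniteType.comp R R' S'⟩

/-- **`Fitt_k(Ω)_x` dies or becomes everything at a generization in the smooth locus.** For
`f : X → Y` locally of finite presentation, `x' ⤳ x` with `x' ∈ sm(X/Y)`:
`Fitt_k(Ω_{𝒪_{X,x}/𝒪_{Y,f x}}) · 𝒪_{X,x'}` is `0` or `𝒪_{X,x'}` (it is `Fitt_k(Ω_{𝒪_{X,x'}/𝒪_{Y,f x}})`,
`𝒪_{X,x'}` being the localization of `𝒪_{X,x}` at `𝔭_{x'}` — Fitting ideals of differentials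
commute with localization, `Module.fittingIdeal_kaehlerDifferential_of_isLocalization'` — and
`𝒪_{X,x'}` is formally smooth,
local, essentially of finite type over `𝒪_{Y,f x}`). [cite: StacksProject, Tag 01V9] -/
theorem map_singFittingIdeal_stalkSpecializes_eq_bot_or_eq_top [LocallyOfFinitePresentation f]
    {x x' : X} (h : x' ⤳ x) (hx' : x' ∈ f.smoothLocus) :
    (Scheme.Hom.singFittingIdeal f x).map (X.presheaf.stalkSpecializes h).hom = ⊥ ∨
      (Scheme.Hom.singFittingIdeal f x).map (X.presheaf.stalkSpecializes h).hom = ⊤ := by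
  set R := Y.presheaf.stalk (f x)
  set S := X.presheaf.stalk x
  set S' := X.presheaf.stalk x'
  letI algRS : Algebra R S := (f.stalkMap x).hom.toAlgebra
  letI algSS' : Algebra S S' := (X.presheaf.stalkSpecializes h).hom.toAlgebra
  letI algRS' : Algebra R S' := ((X.presheaf.stalkSpecializes h).hom.comp (f.stalkMap x).hom).toAlgebra
  haveI : IsScalarTower R S S' := IsScalarTower.of_algebraMap_eq' rfl
  obtain ⟨hfs, hft⟩ := formallySmooth_stalk_of_specializes_of_mem_smoothLocus f h hx'
  haveI := hfs
  haveI := hft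
  haveI : IsLocalization.AtPrime S' (primeOfSpecializes h) := isLocalizationAtPrime_stalkSpecializes h
  haveI : Algebra.EssFiniteType R S := LocallyOfFiniteType.stalkMap f x
  haveI : Module.Finite S Ω[S⁄R] := inferInstance
  have hmap : (Scheme.Hom.singFittingIdeal f x).map (algebraMap S S') =
      Module.fittingIdeal S' Ω[S'⁄R] 1 :=
    (Module.fittingIdeal_kaehlerDifferential_of_isLocalization' (A := R) (B := S) (B' := S')
      (primeOfSpecializes h).primeCompl 1).symm
  change (Scheme.Hom.singFittingIdeal f x).map (algebraMap S S') = ⊥ ∨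
    (Scheme.Hom.singFittingIdeal f x).map (algebraMap S S') = ⊤
  rw [hmap]
  exact fittingIdeal_kaehlerDifferential_eq_bot_or_eq_top R S' 1

end Geometry

/-! ## 3.3 for the curve of Situation 4.23: `Sing(f) ⊆ f⁻¹(D)` on `Spec 𝒪_{X,x}` -/

namespace DeJong1996.SemiStablePair

open Scheme.IdealSheafData

variable {k : Type u} [Field k] {X Y : Scheme.{u}} {f : X ⟶ Y} {g : Y ⟶ Spec (.of k)}
  {D : Set Y} {n : ℕ} {τ : Fin n → (Y ⟶ X)}

/-- In Situation 4.23, a point of `X` over `Y ∖ D` lies in the smooth locus of `f` ("`f` smooth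
over `Y ∖ D`"). [cite: DeJong1996, 4.23, p. 75] -/
theorem mem_smoothLocus_of_apply_notMem (hS : SemiStablePair f g D τ) {x : X} (hx : f x ∉ D) :
    haveI := hS.isSemiStableCurve.locallyOfFinitePresentation
    x ∈ f.smoothLocus := by
  haveI := hS.isSemiStableCurve.locallyOfFinitePresentation
  let V : Y.Opens := ⟨Dᶜ, hS.isStrictNormalCrossingsDivisor.isClosed.isOpen_compl⟩
  have hxV : x ∈ f ⁻¹ᵁ V := hx
  haveI : Smooth (f ∣_ V) := hS.smooth_morphismRestrict
  haveI hsm : Smooth ((f ⁻¹ᵁ V).ι ≫ f) := by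
    rw [← morphismRestrict_ι]
    infer_instance
  have h1 : (⟨x, hxV⟩ : (f ⁻¹ᵁ V : X.Opens)) ∈ ((f ⁻¹ᵁ V).ι ≫ f).smoothLocus := by
    rw [Scheme.Hom.smoothLocus_eq_top]
    trivial
  rw [← Scheme.Hom.preimage_smoothLocus_eq] at h1
  exact h1

/-- **de Jong 1996, 3.3: "By assumption we have `V(h) ⊂ V(t₁ ⋯ t_r)`", on `Spec 𝒪_{X,x}`.** For the
curve `f : X → Y` of a pair in Situation 4.23 (over any field), a point `x`, and a prime `𝔭`
of `𝒪_{X,x}` containing `Fitt₁(Ω_{X/Y})_x` (`Scheme.Hom.singFittingIdeal f x`, the stalk of the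
ideal of `Sing(f)`, 2.21) but NOT the image of the stalk `I(D)_{f x}` of the ideal of `D`: some
`s ∉ 𝔭` annihilates `Fitt₁(Ω_{X/Y})_x`. Indeed `𝔭 = 𝔭_{x'}` for a generization `x' ⤳ x`
(Stacks 01J7); `f x' ∉ D` (else `I(D)_{f x} ⊆ 𝔭_{f x'}` would map into `𝔭`), so `x'` is a
smooth point of `f` (3.1: `f` is smooth over `Y ∖ D`), where `Fitt₁(Ω)_x · 𝒪_{X,x'}` is `0` or
everything (`map_singFittingIdeal_stalkSpecializes_eq_bot_or_eq_top`) — not everything, being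
inside `𝔭 𝒪_{X,x'} = 𝔪_{x'}` — hence `0` in the localization `𝒪_{X,x'} = (𝒪_{X,x})_𝔭` of the
Noetherian `𝒪_{X,x}`. [cite: DeJong1996, 3.3, p. 63] -/
theorem exists_notMem_forall_mul_singFittingIdeal_eq_zero (hS : SemiStablePair f g D τ)
    {x : X} (P : Ideal (X.presheaf.stalk x)) [P.IsPrime]
    (hP : Scheme.Hom.singFittingIdeal f x ≤ P)
    (hD : ¬ (stalkIdeal (vanishingIdeal ⟨D, hS.isStrictNormalCrossingsDivisor.isClosed⟩) (f x)).map
        (f.stalkMap x).hom ≤ P) :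
    ∃ s ∉ P, ∀ a ∈ Scheme.Hom.singFittingIdeal f x, s * a = 0 := by
  haveI := hS.isSemiStableCurve.locallyOfFinitePresentation
  haveI := hS.isIntegral
  haveI : IsNoetherian X := isNoetherian_of_isProjectiveOver _ hS.isProjectiveOver
  -- the generization `x'` with `𝔭 = 𝔭_{x'}`
  obtain ⟨x', h, hPeq⟩ := exists_specializes_comap_stalkSpecializes_eq x P
  have h' : f x' ⤳ f x := f.base.hom.map_specializes h
  -- `f x' ∉ D`
  have hx'D : f x' ∉ D := by
    intro hmem
    apply hD
    have hle := stalkIdeal_vanishingIdeal_le (X := Y) (p := f x)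
      (Z := ⟨D, hS.isStrictNormalCrossingsDivisor.isClosed⟩) h' hmem
    rw [Ideal.map_le_iff_le_comap]
    intro a ha
    rw [Ideal.mem_comap, hPeq, Ideal.mem_comap]
    have h1 : (Y.presheaf.stalkSpecializes h').hom a ∈ maximalIdeal _ := hle ha
    have h2 : (f.stalkMap x').hom ((Y.presheaf.stalkSpecializes h').hom a) ∈ maximalIdeal _ :=
      IsLocalRing.map_maximalIdeal_le (f.stalkMap x').hom (Ideal.mem_map_of_mem _ h1)
    rw [← RingHom.comp_apply, ← CommRingCat.hom_comp, Scheme.Hom.stalkSpecializes_stalkMap f x' x h,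
      CommRingCat.hom_comp, RingHom.comp_apply] at h2
    exact h2
  -- so `x'` is a smooth point of `f`
  have hx'sm : x' ∈ f.smoothLocus := hS.mem_smoothLocus_of_apply_notMem hx'D
  -- `Fitt₁ · 𝒪_{X,x'}` is `0` or everything, and not everything
  letI algSS' : Algebra (X.presheaf.stalk x) (X.presheaf.stalk x') :=
    (X.presheaf.stalkSpecializes h).hom.toAlgebra
  haveI : IsLocalization.AtPrime (X.presheaf.stalk x') (primeOfSpecializes h) :=
    isLocalizationAtPrime_stalkSpecializes h
  have hbot : (Scheme.Hom.singFittingIdeal f x).map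
      (algebraMap (X.presheaf.stalk x) (X.presheaf.stalk x')) = ⊥ := by
    rcases map_singFittingIdeal_stalkSpecializes_eq_bot_or_eq_top f h hx'sm with hb | ht
    · exact hb
    · exfalso
      have hle : (Scheme.Hom.singFittingIdeal f x).map
          (algebraMap (X.presheaf.stalk x) (X.presheaf.stalk x')) ≤ maximalIdeal _ := by
        rw [Ideal.map_le_iff_le_comap]
        intro a ha
        have : a ∈ P := hP ha
        rw [hPeq] at this
        exact this
      change (Scheme.Hom.singFittingIdeal f x).map
        (algebraMap (X.presheaf.stalk x) (X.presheaf.stalk x')) = ⊤ at ht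
      rw [ht, top_le_iff] at hle
      exact (maximalIdeal.isMaximal _).ne_top hle
  haveI : (primeOfSpecializes h).IsPrime := Ideal.IsPrime.comap _
  obtain ⟨s, hs, hsa⟩ := Ideal.exists_notMem_forall_mul_eq_zero_of_map_eq_bot
    (S' := X.presheaf.stalk x') (primeOfSpecializes h) (IsNoetherian.noetherian _) hbot
  refine ⟨s, ?_, hsa⟩
  rw [hPeq]
  exact hs

/-- The same, as an inclusion of radicals: **`I(D)_{f x} · 𝒪_{X,x} ⊆ 𝔭` for every prime
`𝔭 ⊇ Fitt₁(Ω_{X/Y})_x` of `𝒪_{X,x}` off which `Fitt₁(Ω_{X/Y})_x` has no torsion** — the form in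
which 2.23 ("the trace of `Sing(f)` on `Spec B` is given by the ideal `(u, v)`", no non-zero
element of `𝒪_{X,x}` killing both `u` and `v`) turns it into `V(h) ⊆ V(t₁ ⋯ t_r)`.
[cite: DeJong1996, 3.3, p. 63] -/
theorem map_stalkIdeal_le_of_singFittingIdeal_le (hS : SemiStablePair f g D τ) {x : X}
    (P : Ideal (X.presheaf.stalk x)) [P.IsPrime] (hP : Scheme.Hom.singFittingIdeal f x ≤ P)
    (htors : ∀ s : X.presheaf.stalk x, (∀ a ∈ Scheme.Hom.singFittingIdeal f x, s * a = 0) → s ∈ P) :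
    (stalkIdeal (vanishingIdeal ⟨D, hS.isStrictNormalCrossingsDivisor.isClosed⟩) (f x)).map
        (f.stalkMap x).hom ≤ P := by
  by_contra hD
  obtain ⟨s, hs, hsa⟩ := hS.exists_notMem_forall_mul_singFittingIdeal_eq_zero P hP hD
  exact hs (htors s hsa)

end DeJong1996.SemiStablePair

end Literature.AlgebraicGeometry.Resolution

end
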